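import Literature.Geometry.Riemannian.MVbClosed
import Literature.Geometry.Riemannian.FiniteModelsGW1
import Literature.Geometry.Riemannian.FiniteApproximation
import HarnessLib

/-!
# `(𝕄_r(V, b), d_{GW₁})` is compact (Bamler 2023, §2.5, Theorem)

R. Bamler, *Compactness theory of the space of super Ricci flows*, Invent. Math. 233 (2023), §2.5,
Theorem: *"`(𝕄_r(V, b), d_{GW₁})` is compact."* Printed proof: *"Due to Theorem 2.17 [completeness]
and Lemma 2.21 [closedness], we only need to establish total boundedness. This is a consequence of
the following lemma [finite approximation] … Since there are only finitely many such isometry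
classes `(X', d|_{X'}, μ')` up to `α`-closeness, this lemma implies that `𝕄_r(V, b)` can be
covered by finitely many `2α`-balls"*. We prove the Theorem as **sequential compactness** (the
form in which it is used): every sequence in `𝕄_r(V, b)` has a subsequence `d_{GW₁}`-converging
to a member of `𝕄_r(V, b)`.

* `exists_finite_net` — **total boundedness**: for `α > 0`, finitely many members of the sequence
  are `α`-dense in it (finite approximation `FiniteApproximation.lean`, compactness of the
  parameter cube of distance matrices and weights, comparison of finite models
  `FiniteModelsGW1.lean`);
* `exists_cauchySeq_subseq_of_finite_nets` — a totally bounded sequence (for a `[0, ∞]`-valued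
  pseudo-distance) has a Cauchy subsequence (pigeonhole along a free ultrafilter);
* `IsMVb.exists_tendsto_subseq` — **the Theorem** (with `GromovW1Complete.lean` and
  `MVbClosed.lean`).

Everything is proved; no definitions, no named facts.

## References

* R. H. Bamler, *Compactness theory of the space of super Ricci flows*, Invent. Math. 233 (2023),
  §2.5, Theorem ((𝕄_r(V, b), d_{GW₁}) is compact), proof. [Bamler2023]
-/

noncomputable section

open Set MeasureTheory Filter Topology Metric Function
open scoped ENNReal NNReal

namespace Literature.Geometry.Riemannian

universe u

/-! ### Cauchy subsequences from finite nets -/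

/-- **A totally bounded sequence has a Cauchy subsequence** (for a symmetric `[0, ∞]`-valued `G`
satisfying the triangle inequality): if for every `α > 0` finitely many indices are `α`-dense, some
subsequence is `G`-Cauchy. Proof: along a free ultrafilter one of the finitely many `α`-balls is
large; intersect these large sets scale by scale. [folklore] -/
theorem exists_cauchySeq_subseq_of_finite_nets {G : ℕ → ℕ → ℝ≥0∞} (hsymm : ∀ i j, G i j = G j i)
    (htri : ∀ i j k, G i k ≤ G i j + G j k)
    (hnet : ∀ α : ℝ≥0∞, 0 < α → ∃ t : Finset ℕ, ∀ i, ∃ j ∈ t, G i j < α) :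
    ∃ φ : ℕ → ℕ, StrictMono φ ∧
      ∀ α : ℝ≥0∞, 0 < α → ∃ N, ∀ k ≥ N, ∀ l ≥ N, G (φ k) (φ l) < α := by
  classical
  set U : Ultrafilter ℕ := hyperfilter ℕ with hU
  -- scale `n`: a large set of pairwise distance `< 2 (n+1)⁻¹`
  have hscale : ∀ n : ℕ, ∃ S : Set ℕ, S ∈ U ∧ ∀ i ∈ S, ∀ i' ∈ S,
      G i i' < 2 * ((n : ℝ≥0∞) + 1)⁻¹ := by
    intro n
    have hpos : (0 : ℝ≥0∞) < ((n : ℝ≥0∞) + 1)⁻¹ := ENNReal.inv_pos.2 (by simp)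
    obtain ⟨t, ht⟩ := hnet _ hpos
    have hcov : (⋃ j ∈ (t : Set ℕ), {i | G i j < ((n : ℝ≥0∞) + 1)⁻¹}) = univ := by
      refine eq_univ_of_forall fun i ↦ ?_
      obtain ⟨j, hj, hij⟩ := ht i
      exact mem_iUnion₂.2 ⟨j, hj, hij⟩
    have hmem : (⋃ j ∈ (t : Set ℕ), {i | G i j < ((n : ℝ≥0∞) + 1)⁻¹}) ∈ U := by
      rw [hcov]
      exact univ_mem
    obtain ⟨j, -, hj⟩ := (Ultrafilter.finite_biUnion_mem_iff t.finite_toSet).1 hmem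
    refine ⟨_, hj, fun i hi i' hi' ↦ ?_⟩
    rw [mem_setOf_eq] at hi hi'
    calc G i i' ≤ G i j + G j i' := htri _ _ _
      _ < ((n : ℝ≥0∞) + 1)⁻¹ + ((n : ℝ≥0∞) + 1)⁻¹ := by
          rw [hsymm j i']
          exact ENNReal.add_lt_add hi hi'
      _ = 2 * ((n : ℝ≥0∞) + 1)⁻¹ := by rw [two_mul]
  choose S hSU hS using hscale
  -- the nested large sets and the subsequence
  set D : ℕ → Set ℕ := fun n ↦ ⋂ l ∈ Finset.range (n + 1), S l with hD
  have hDU : ∀ n, D n ∈ U := fun n ↦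
    (Filter.biInter_finset_mem (Finset.range (n + 1))).2 fun l _ ↦ hSU l
  have hDinf : ∀ n, (D n).Infinite := fun n hfin ↦ hfin.notMem_hyperfilter (hDU n)
  have hDS : ∀ {n l}, l ≤ n → D n ⊆ S l := fun {n l} hl i hi ↦ by
    simp only [hD, mem_iInter, Finset.mem_range] at hi
    exact hi l (Nat.lt_succ_of_le hl)
  choose g hg using fun n a ↦ (hDinf n).exists_gt a
  let φ : ℕ → ℕ := fun n ↦ Nat.rec (g 0 0) (fun k a ↦ g (k + 1) a) n
  have hφmem : ∀ n, φ n ∈ D n := by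
    intro n
    cases n with
    | zero => exact (hg 0 0).1
    | succ k => exact (hg (k + 1) _).1
  have hφlt : ∀ n, φ n < φ (n + 1) := fun n ↦ (hg (n + 1) _).2
  refine ⟨φ, strictMono_nat_of_lt_succ hφlt, fun α hα ↦ ?_⟩
  -- choose the scale
  obtain ⟨n, hn⟩ := ENNReal.exists_inv_nat_lt (ENNReal.half_pos hα.ne').ne'
  refine ⟨n, fun k hk l hl ↦ ?_⟩
  have hk' : φ k ∈ S n := hDS hk (hφmem k)
  have hl' : φ l ∈ S n := hDS hl (hφmem l)
  calc G (φ k) (φ l) < 2 * ((n : ℝ≥0∞) + 1)⁻¹ := hS n _ hk' _ hl'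
    _ ≤ 2 * (n : ℝ≥0∞)⁻¹ := by
        gcongr
        exact le_self_add
    _ ≤ 2 * (α / 2) := by gcongr
    _ = α := ENNReal.mul_div_cancel (by norm_num) (by norm_num)

/-! ### Total boundedness of `𝕄_r(V, b)` -/

variable {X : ℕ → Type u} [∀ i, MetricSpace (X i)] [∀ i, MeasurableSpace (X i)]
  [∀ i, BorelSpace (X i)] [∀ i, SecondCountableTopology (X i)] [∀ i, CompleteSpace (X i)]

/-- **Total boundedness of `𝕄_r(V, b)`** (Bamler 2023, §2.5, proof of the Theorem: *"𝕄_r(V, b)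
can be covered by finitely many `2α`-balls"*), along a sequence: for every `α > 0` finitely many
members of a sequence in `𝕄_r(V, b)` are `α`-dense in it for `d_{GW₁}`. Proof: the finite
approximation Lemma gives models `(x^i_p, w^i_p)_{p ∈ F}` on a fixed finite index set `F` with
`d_{GW₁}(Xᵢ, model) ≤ (εV)^{1/2} r + 2εr`; their parameters (distance matrix, weights) lie in a
compact cube, which is covered by finitely many small balls; models with close parameters are
`d_{GW₁}`-close (`gromovW1_map_map_le_of_abs_dist_sub_dist_le`).
[cite: Bamler2023, §2.5, Theorem ((𝕄_r(V, b), d_{GW₁}) is compact), proof] -/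
theorem IsMVb.exists_finite_net (μ : ∀ i, Measure (X i)) [∀ i, IsProbabilityMeasure (μ i)]
    {r V : ℝ} {b : ℝ → ℝ≥0∞} (hr : 0 < r) (hV0 : 0 ≤ V)
    (hb0 : ∀ ε, 0 < ε → ε ≤ 1 → b ε ≠ 0) (hb1 : ∀ ε, b ε ≤ 1) (h : ∀ i, IsMVb (μ i) r V b)
    {α : ℝ} (hα : 0 < α) :
    ∃ t : Finset ℕ, ∀ i, ∃ j ∈ t, gromovW1 (μ i) (μ j) < ENNReal.ofReal α := by
  classical
  haveI : ∀ i, Nonempty (X i) := fun i ↦ nonempty_of_isProbabilityMeasure' (μ i)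
  -- Step 1: the scale `ε` with `δ := (ε V r²)^{1/2} + 2 ε r < α / 4`
  obtain ⟨ε, hε0, hε1, hδ⟩ : ∃ ε : ℝ, 0 < ε ∧ ε ≤ 1 ∧
      Real.sqrt (ε * (V * r ^ 2)) + 2 * (ε * r) < α / 4 := by
    have hcont : Continuous fun ε : ℝ ↦ Real.sqrt (ε * (V * r ^ 2)) + 2 * (ε * r) := by
      fun_prop
    have h0 : (fun ε : ℝ ↦ Real.sqrt (ε * (V * r ^ 2)) + 2 * (ε * r)) 0 < α / 4 := by
      simp only [zero_mul, Real.sqrt_zero, mul_zero, add_zero]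
      positivity
    have hev : ∀ᶠ ε in 𝓝[>] (0 : ℝ),
        Real.sqrt (ε * (V * r ^ 2)) + 2 * (ε * r) < α / 4 ∧ ε ∈ Ioo (0 : ℝ) 1 :=
      (((hcont.tendsto 0).mono_left nhdsWithin_le_nhds).eventually (gt_mem_nhds h0)).and
        (Ioo_mem_nhdsGT zero_lt_one)
    obtain ⟨ε, hlt, hmem⟩ := hev.exists
    exact ⟨ε, hmem.1, hmem.2.le, hlt⟩
  set δ : ℝ := Real.sqrt (ε * (V * r ^ 2)) + 2 * (ε * r) with hδdef
  have hδ0 : 0 ≤ δ := by positivity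
  set β : ℝ≥0∞ := b ε with hβdef
  have hβ0 : β ≠ 0 := hb0 ε hε0 hε1
  have hβ1 : β ≤ 1 := hb1 ε
  have hβtop : β ≠ ∞ := ne_top_of_le_ne_top ENNReal.one_ne_top hβ1
  have hβr : 0 < β.toReal := ENNReal.toReal_pos hβ0 hβtop
  set N : ℕ := ⌊β.toReal⁻¹⌋₊ with hN
  set Dm : ℝ := Real.sqrt (V * r ^ 2) / β.toReal ^ 2 + 2 * (ε * r) with hDm
  have hDm0 : 0 ≤ Dm := by positivity
  have hρ : 0 < ε * r := mul_pos hε0 hr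
  have hVr0 : 0 ≤ V * r ^ 2 := by positivity
  -- Step 2: the finite models
  have hthin : ∀ i, μ i (thinSet (μ i) (ε * r) β) ≤ ENNReal.ofReal ε := fun i ↦
    (le_massDistribution_iff _ _ _ hβ1).1 ((h i).2 ε ⟨hε0, hε1⟩)
  choose x T hT hdist hcost using fun i ↦
    exists_finite_approximation (μ i) hVr0 (h i).1 hρ hβ0 hβ1 hε0.le (hthin i)
  have hmx : ∀ i, Measurable (x i) := fun i ↦ measurable_of_countable _
  set w : ∀ i, Measure (Fin (N + 1)) := fun i ↦ (μ i).map (T i) with hw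
  haveI : ∀ i, IsProbabilityMeasure (w i) := fun i ↦
    Measure.isProbabilityMeasure_map (hT i).aemeasurable
  haveI : ∀ i, IsProbabilityMeasure ((w i).map (x i)) := fun i ↦
    Measure.isProbabilityMeasure_map (hmx i).aemeasurable
  have hmodel : ∀ i, gromovW1 (μ i) ((w i).map (x i)) ≤ ENNReal.ofReal δ := by
    intro i
    have hmap : (w i).map (x i) = (μ i).map (x i ∘ T i) := Measure.map_map (hmx i) (hT i)
    rw [hmap]
    haveI : IsProbabilityMeasure ((μ i).map (x i ∘ T i)) :=
      Measure.isProbabilityMeasure_map ((hmx i).comp (hT i)).aemeasurable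
    refine (gromovW1_le_wassersteinW1 (μ i) ((μ i).map (x i ∘ T i))).trans ?_
    exact (wassersteinW1_map_le_lintegral_edist (μ i) ((hmx i).comp (hT i))).trans (hcost i)
  -- Step 3: parameters in a compact cube
  let θ : ℕ → (Fin (N + 1) × Fin (N + 1) → ℝ) × (Fin (N + 1) → ℝ) := fun i ↦
    (fun pq ↦ dist (x i pq.1) (x i pq.2), fun p ↦ ((w i) {p}).toReal)
  set K : Set ((Fin (N + 1) × Fin (N + 1) → ℝ) × (Fin (N + 1) → ℝ)) :=
    (Set.pi univ fun _ ↦ Icc 0 Dm) ×ˢ (Set.pi univ fun _ ↦ Icc (0 : ℝ) 1) with hK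
  have hKc : IsCompact K :=
    (isCompact_univ_pi fun _ ↦ isCompact_Icc).prod (isCompact_univ_pi fun _ ↦ isCompact_Icc)
  have hθK : ∀ i, θ i ∈ K := by
    intro i
    refine ⟨fun pq _ ↦ ⟨dist_nonneg, hdist i pq.1 pq.2⟩, fun p _ ↦ ⟨ENNReal.toReal_nonneg, ?_⟩⟩
    exact ENNReal.toReal_le_of_le_ofReal zero_le_one (by rw [ENNReal.ofReal_one]; exact prob_le_one)
  -- Step 4: the parameter scale `η`
  set η : ℝ := min (α / 4) (α / (8 * (Dm * (N + 1) + 1))) with hη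
  have hη0 : 0 < η := by positivity
  have hη1 : η / 2 ≤ α / 8 := by
    have := min_le_left (α / 4) (α / (8 * (Dm * (N + 1) + 1)))
    linarith
  have hη2 : Dm * ((N + 1) * η) ≤ α / 8 := by
    have hle := min_le_right (α / 4) (α / (8 * (Dm * (N + 1) + 1)))
    calc Dm * ((N + 1) * η) = (Dm * (N + 1)) * η := by ring
      _ ≤ (Dm * (N + 1)) * (α / (8 * (Dm * (N + 1) + 1))) := by gcongr
      _ ≤ α / 8 := by
          rw [← mul_div_assoc, div_le_div_iff₀ (by positivity) (by norm_num)]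
          nlinarith [hα, hDm0]
  -- Step 5: the finite cover of `K` and representatives
  obtain ⟨c, -, hcfin, hcov⟩ := finite_cover_balls_of_compact hKc (half_pos hη0)
  let rep : ((Fin (N + 1) × Fin (N + 1) → ℝ) × (Fin (N + 1) → ℝ)) → ℕ := fun z ↦
    if hz : ∃ i, θ i ∈ ball z (η / 2) then hz.choose else 0
  refine ⟨hcfin.toFinset.image rep, fun i ↦ ?_⟩
  obtain ⟨z, hz, hiz⟩ : ∃ z ∈ c, θ i ∈ ball z (η / 2) := by
    have := hcov (hθK i)
    simpa only [mem_iUnion, exists_prop] using this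
  have hex : ∃ i, θ i ∈ ball z (η / 2) := ⟨i, hiz⟩
  have hjz : θ (rep z) ∈ ball z (η / 2) := by
    have : rep z = hex.choose := dif_pos hex
    rw [this]
    exact hex.choose_spec
  refine ⟨rep z, Finset.mem_image_of_mem _ (hcfin.mem_toFinset.2 hz), ?_⟩
  set j := rep z with hj
  -- the parameters of `i` and `j` are `η`-close
  have hθ : dist (θ i) (θ j) < η := by
    calc dist (θ i) (θ j) ≤ dist (θ i) z + dist z (θ j) := dist_triangle _ _ _
      _ < η / 2 + η / 2 :=
          add_lt_add (mem_ball.1 hiz) (by rw [dist_comm]; exact mem_ball.1 hjz)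
      _ = η := add_halves η
  have hθ' := hθ
  rw [Prod.dist_eq, max_lt_iff] at hθ'
  have hmat : ∀ p q, |dist (x i p) (x i q) - dist (x j p) (x j q)| ≤ 2 * (η / 2) := by
    intro p q
    have h2 := dist_le_pi_dist (θ i).1 (θ j).1 (p, q)
    rw [Real.dist_eq] at h2
    change |dist (x i p) (x i q) - dist (x j p) (x j q)| ≤ _ at h2
    linarith [hθ'.1]
  have hwt : ∀ p, (w i) {p} - (w j) {p} ≤ ENNReal.ofReal η := by
    intro p
    have h2 := dist_le_pi_dist (θ i).2 (θ j).2 p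
    rw [Real.dist_eq] at h2
    change |((w i) {p}).toReal - ((w j) {p}).toReal| ≤ _ at h2
    rw [← ENNReal.ofReal_toReal (measure_ne_top (w i) {p}),
      ← ENNReal.ofReal_toReal (measure_ne_top (w j) {p}),
      ← ENNReal.ofReal_sub _ ENNReal.toReal_nonneg]
    refine ENNReal.ofReal_le_ofReal ?_
    linarith [hθ'.2, le_abs_self (((w i) {p}).toReal - ((w j) {p}).toReal)]
  have hsum : ∑ p, ((w i) {p} - (w j) {p}) ≤ ((N : ℝ≥0∞) + 1) * ENNReal.ofReal η := by
    calc ∑ p, ((w i) {p} - (w j) {p}) ≤ ∑ _p : Fin (N + 1), ENNReal.ofReal η :=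
          Finset.sum_le_sum fun p _ ↦ hwt p
      _ = ((N : ℝ≥0∞) + 1) * ENNReal.ofReal η := by
          rw [Finset.sum_const, Finset.card_univ, Fintype.card_fin, nsmul_eq_mul]
          push_cast
          ring
  -- Step 6: comparison of the models and conclusion
  have hmid : gromovW1 ((w i).map (x i)) ((w j).map (x j)) ≤
      ENNReal.ofReal (η / 2) + ENNReal.ofReal Dm * (((N : ℝ≥0∞) + 1) * ENNReal.ofReal η) :=
    (gromovW1_map_map_le_of_abs_dist_sub_dist_le (w i) (w j) (x i) (x j) (half_pos hη0) hmat
      (fun p q ↦ hdist j p q)).trans (add_le_add le_rfl (by gcongr))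
  have hconv : ENNReal.ofReal Dm * (((N : ℝ≥0∞) + 1) * ENNReal.ofReal η) =
      ENNReal.ofReal (Dm * ((N + 1) * η)) := by
    rw [ENNReal.ofReal_mul hDm0, ENNReal.ofReal_mul (by positivity),
      ENNReal.ofReal_add (by positivity) zero_le_one, ENNReal.ofReal_natCast, ENNReal.ofReal_one]
  calc gromovW1 (μ i) (μ j)
      ≤ gromovW1 (μ i) ((w i).map (x i)) + gromovW1 ((w i).map (x i)) (μ j) :=
        gromovW1_triangle _ _ _
    _ ≤ gromovW1 (μ i) ((w i).map (x i)) +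
          (gromovW1 ((w i).map (x i)) ((w j).map (x j)) + gromovW1 ((w j).map (x j)) (μ j)) :=
        add_le_add le_rfl (gromovW1_triangle _ _ _)
    _ ≤ ENNReal.ofReal δ + ((ENNReal.ofReal (η / 2) +
          ENNReal.ofReal Dm * (((N : ℝ≥0∞) + 1) * ENNReal.ofReal η)) + ENNReal.ofReal δ) := by
        gcongr
        · exact hmodel i
        · rw [gromovW1_comm]
          exact hmodel j
    _ = ENNReal.ofReal (δ + ((η / 2 + Dm * ((N + 1) * η)) + δ)) := by
        rw [hconv, ← ENNReal.ofReal_add (by positivity) (by positivity),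
          ← ENNReal.ofReal_add (by positivity) hδ0, ← ENNReal.ofReal_add hδ0 (by positivity)]
    _ < ENNReal.ofReal α := by
        rw [ENNReal.ofReal_lt_ofReal_iff hα]
        linarith

/-! ### The Theorem -/

/-- **`(𝕄_r(V, b), d_{GW₁})` is compact** (Bamler 2023, §2.5, Theorem), as sequential
compactness: every sequence `(Xᵢ, dᵢ, μᵢ)` in `𝕄_r(V, b)` (probability measures on complete
separable metric spaces with `Var ≤ V r²` and `b_r ≥ b`, for `r > 0`, `V ≥ 0` and
`b : (0, 1] → (0, 1]`) has a subsequence `d_{GW₁}`-converging to some `(S, d_S, ρ) ∈ 𝕄_r(V, b)`.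
Printed proof: total boundedness (`IsMVb.exists_finite_net`) gives a Cauchy subsequence
(`exists_cauchySeq_subseq_of_finite_nets`), which converges by the completeness Theorem
(`gromovW1_completeness`); the limit lies in `𝕄_r(V, b)` by closedness
(`IsMVb.of_tendsto_gromovW1`). [cite: Bamler2023, §2.5, Theorem ((𝕄_r(V, b), d_{GW₁}) is compact)] -/
theorem IsMVb.exists_tendsto_subseq (μ : ∀ i, Measure (X i)) [∀ i, IsProbabilityMeasure (μ i)]
    {r V : ℝ} {b : ℝ → ℝ≥0∞} (hr : 0 < r) (hV0 : 0 ≤ V)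
    (hb0 : ∀ ε, 0 < ε → ε ≤ 1 → b ε ≠ 0) (hb1 : ∀ ε, b ε ≤ 1) (h : ∀ i, IsMVb (μ i) r V b) :
    ∃ φ : ℕ → ℕ, StrictMono φ ∧
      ∃ (S : Type u) (_ : MetricSpace S) (_ : MeasurableSpace S) (_ : BorelSpace S)
        (_ : SecondCountableTopology S) (_ : CompleteSpace S) (ρ : Measure S),
        IsProbabilityMeasure ρ ∧ IsMVb ρ r V b ∧
          Tendsto (fun k ↦ gromovW1 (μ (φ k)) ρ) atTop (𝓝 0) := by
  -- total boundedness in the `[0, ∞]`-valued form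
  have hnet : ∀ α : ℝ≥0∞, 0 < α → ∃ t : Finset ℕ, ∀ i, ∃ j ∈ t, gromovW1 (μ i) (μ j) < α := by
    intro α hα
    have hα' : 0 < (min α 1).toReal := ENNReal.toReal_pos (lt_min hα zero_lt_one).ne'
      (ne_top_of_le_ne_top ENNReal.one_ne_top (min_le_right _ _))
    obtain ⟨t, ht⟩ := IsMVb.exists_finite_net μ hr hV0 hb0 hb1 h hα'
    refine ⟨t, fun i ↦ ?_⟩
    obtain ⟨j, hj, hlt⟩ := ht i
    refine ⟨j, hj, hlt.trans_le ?_⟩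
    rw [ENNReal.ofReal_toReal (ne_top_of_le_ne_top ENNReal.one_ne_top (min_le_right _ _))]
    exact min_le_left _ _
  obtain ⟨φ, hφ, hC⟩ := exists_cauchySeq_subseq_of_finite_nets
    (fun i j ↦ gromovW1_comm (μ i) (μ j)) (fun i j k ↦ gromovW1_triangle (μ i) (μ j) (μ k)) hnet
  obtain ⟨S, i1, i2, i3, i4, i5, ρ, hρ, hlim⟩ :=
    gromovW1_completeness (X := fun k ↦ X (φ k)) (fun k ↦ μ (φ k)) hC
  exact ⟨φ, hφ, S, i1, i2, i3, i4, i5, ρ, hρ,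
    IsMVb.of_tendsto_gromovW1 hlim hb1 fun k ↦ h (φ k), hlim⟩

end Literature.Geometry.Riemannian

end
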